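import Literature.RingTheory.DiscreteValuationRing.AdicCompletionResidueField
import HarnessLib

/-!
# Residue maps of `O_v` extending a residue map of the global ring, and unit squares in `O_v`

Topic `NumberTheory/NumberFields` (stated for any Dedekind domain `A` with fraction field `K`), namespace
`Literature.NumberTheory.NumberFields`. Complete `2`-descents over a number field `K ≠ ℚ` (tree
`TwoIsogenySelmerGroupShaNF`, Silverman *AEC* X.4.9 over `K`) decide the local conditions `[d]_v ∈ α(W(K_v))` at a
finite place `v` by a congruence on `d` modulo `v`; the passage from the completion `K_v` back to the residue ring
`A ⧸ v` (Serre, *Local Fields*, II §1; Neukirch II.4.3: `O_v/𝔪_v = A/v`) is packaged here in the form that is used: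

* `exists_ringHom_adicCompletionIntegers_extending` — **every surjective residue map `ψ : A → R` with kernel `v` extends to
  `O_v`**: there is a ring homomorphism `ρ : O_v →+* R` with `ρ ∘ (A → O_v) = ψ` whose kernel is the maximal ideal
  (built from the tree's `residueFieldEquiv : A ⧸ v ≃+* κ(O_v)`);
* (`z ∈ 𝔪_v ↔ v(z) < 1` is the tree's `TateNormalForm.mem_maximalIdeal_iff_v_lt_one`; `a ∉ v ⇒ a ∈ O_vˣ` is the
  tree's `IsDedekindDomain.HeightOneSpectrum.isUnit_algebraMap_adicCompletionIntegers` — not restated here);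
* `exists_isUnit_mul_eq_sq_of_mul_eq_sq` — if two `v`-adic units of `O_v` have a product which is a square in `K_v`,
  it is the square of a unit of `O_v` (so their residues have square product);
* `residue_mul_eq_sq_of_mul_eq_sq` — the same read through `ρ`: `ρ(d) ρ(s) = r²` with `r` a unit of `R`.

Theorems only (no definitions: `ρ` is provided existentially), no named facts.

## References
* J.-P. Serre, *Local Fields*, GTM 67 (1979), Ch. II §1 (residue field of a completion). [cite: Serre1979, II §1]
* J. Neukirch, *Algebraic Number Theory* (1999), Ch. II Prop. 4.3.
* J. H. Silverman, *The Arithmetic of Elliptic Curves*, 2nd ed. (2009), X.4.9 (local conditions of the `2`-isogeny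
  Selmer group decided by residues).
-/

noncomputable section

open IsLocalRing IsDedekindDomain

namespace Literature.NumberTheory.NumberFields

variable {A : Type*} [CommRing A] [IsDedekindDomain A] (K : Type*) [Field K] [Algebra A K]
  [IsFractionRing A K] (v : HeightOneSpectrum A)

/-- **`z ∈ 𝔪_v ↔ v(z) < 1`** for `z ∈ O_v` (`O_v = {v ≤ 1}`, units `= {v = 1}`). [folklore] -/
private theorem mem_maximalIdeal_iff_valued_lt_one (z : v.adicCompletionIntegers K) :
    z ∈ maximalIdeal (v.adicCompletionIntegers K) ↔ Valued.v (z : v.adicCompletion K) < 1 := by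
  rw [mem_maximalIdeal, mem_nonunits_iff, HeightOneSpectrum.adicCompletionIntegers.isUnit_iff_valued_eq_one]
  have hle : Valued.v (z : v.adicCompletion K) ≤ 1 := (HeightOneSpectrum.mem_adicCompletionIntegers A K v).mp z.2
  exact ⟨fun h => lt_of_le_of_ne hle h, fun h => h.ne⟩

/-- **Residue maps of `A` at `v` extend to `O_v`.** If `ψ : A → R` is a surjective ring homomorphism with kernel `v`
(a model `R` of the residue field `A ⧸ v`, e.g. `R = ℤ/ℓ` at a place of degree one), there is `ρ : O_v →+* R` with
`ρ(a) = ψ(a)` for `a ∈ A` and `ρ(z) = 0 ↔ z ∈ 𝔪_v`: `ρ = (A ⧸ ker ψ ≅ R) ∘ (A ⧸ v ≅ κ(O_v))⁻¹ ∘ (O_v → κ(O_v))`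
(Serre, *Local Fields*, II §1: `κ(O_v) = A ⧸ v`). [cite: Serre1979, II §1] -/
theorem exists_ringHom_adicCompletionIntegers_extending {R : Type*} [CommRing R] (ψ : A →+* R)
    (hψ : Function.Surjective ψ) (hker : RingHom.ker ψ = v.asIdeal) :
    ∃ ρ : v.adicCompletionIntegers K →+* R,
      (∀ a : A, ρ (algebraMap A (v.adicCompletionIntegers K) a) = ψ a) ∧
        ∀ z, ρ z = 0 ↔ z ∈ maximalIdeal (v.adicCompletionIntegers K) := by
  let e₁ := HeightOneSpectrum.residueFieldEquiv K v
  let e₀ : A ⧸ v.asIdeal ≃+* A ⧸ RingHom.ker ψ := Ideal.quotEquivOfEq hker.symm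
  let e₂ : A ⧸ RingHom.ker ψ ≃+* R := RingHom.quotientKerEquivOfSurjective hψ
  refine ⟨e₂.toRingHom.comp (e₀.toRingHom.comp (e₁.symm.toRingHom.comp (residue _))), fun a => ?_, fun z => ?_⟩
  · simp only [RingHom.comp_apply, RingEquiv.toRingHom_eq_coe, RingEquiv.coe_toRingHom]
    rw [← HeightOneSpectrum.residueFieldEquiv_apply_mk, RingEquiv.symm_apply_apply]
    change e₂ (e₀ (Ideal.Quotient.mk v.asIdeal a)) = ψ a
    rw [show e₀ (Ideal.Quotient.mk v.asIdeal a) = Ideal.Quotient.mk (RingHom.ker ψ) a from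
      Ideal.quotEquivOfEq_mk _ _]
    exact RingHom.quotientKerEquivOfSurjective_apply_mk hψ a
  · simp only [RingHom.comp_apply, RingEquiv.toRingHom_eq_coe, RingEquiv.coe_toRingHom,
      map_eq_zero_iff _ (RingEquiv.injective _), residue_eq_zero_iff]

/-- **Residue maps at `v` extend to `O_v`, valuation form of the kernel**: as
`exists_ringHom_adicCompletionIntegers_extending`, with `ρ(z) = 0 ↔ v(z) < 1`. [cite: Serre1979, II §1] -/
theorem exists_ringHom_adicCompletionIntegers_extending' {R : Type*} [CommRing R] (ψ : A →+* R)
    (hψ : Function.Surjective ψ) (hker : RingHom.ker ψ = v.asIdeal) :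
    ∃ ρ : v.adicCompletionIntegers K →+* R,
      (∀ a : A, ρ (algebraMap A (v.adicCompletionIntegers K) a) = ψ a) ∧
        ∀ z, ρ z = 0 ↔ Valued.v (z : v.adicCompletion K) < 1 := by
  obtain ⟨ρ, h1, h2⟩ := exists_ringHom_adicCompletionIntegers_extending K v ψ hψ hker
  exact ⟨ρ, h1, fun z => (h2 z).trans (mem_maximalIdeal_iff_valued_lt_one K v z)⟩

/-- **A product of two units of `O_v` that is a square in `K_v` is the square of a unit of `O_v`** (`v(c)² = 1` forces
`v(c) = 1`). [cite: Serre1979, II §1] -/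
theorem exists_isUnit_mul_eq_sq_of_mul_eq_sq {d s : v.adicCompletionIntegers K} (hd : IsUnit d) (hs : IsUnit s)
    {c : v.adicCompletion K} (h : (d : v.adicCompletion K) * s = c ^ 2) :
    ∃ u : v.adicCompletionIntegers K, IsUnit u ∧ d * s = u ^ 2 := by
  rw [HeightOneSpectrum.adicCompletionIntegers.isUnit_iff_valued_eq_one] at hd hs
  have hvc : Valued.v c = 1 := by
    have hcp : Valued.v c ^ 2 = 1 := by rw [← map_pow, ← h, map_mul, hd, hs, one_mul]
    rcases lt_trichotomy (Valued.v c) 1 with hlt | heq | hgt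
    · exact absurd hcp (pow_lt_one₀ zero_le hlt two_ne_zero).ne
    · exact heq
    · exact absurd hcp (one_lt_pow₀ hgt two_ne_zero).ne'
  refine ⟨⟨c, (HeightOneSpectrum.mem_adicCompletionIntegers A K v).mpr hvc.le⟩, ?_, ?_⟩
  · rw [HeightOneSpectrum.adicCompletionIntegers.isUnit_iff_valued_eq_one]; exact hvc
  · exact Subtype.ext h

/-- **Residues of units with square product**: if `d, s ∈ O_vˣ` have `d s = c²` in `K_v`, then for any ring map
`ρ : O_v → R`, `ρ(d) ρ(s) = r²` with `r` a unit (used with `ρ` the residue map: the residues of `d` and `s` differ by a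
non-zero square). [cite: Serre1979, II §1] -/
theorem residue_mul_eq_sq_of_mul_eq_sq {R : Type*} [CommRing R] (ρ : v.adicCompletionIntegers K →+* R)
    {d s : v.adicCompletionIntegers K} (hd : IsUnit d) (hs : IsUnit s)
    {c : v.adicCompletion K} (h : (d : v.adicCompletion K) * s = c ^ 2) :
    ∃ r : R, IsUnit r ∧ ρ d * ρ s = r ^ 2 := by
  obtain ⟨u, hu, hds⟩ := exists_isUnit_mul_eq_sq_of_mul_eq_sq K v hd hs h
  exact ⟨ρ u, hu.map ρ, by rw [← map_mul, hds, map_pow]⟩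

/-- **The image of `a ∈ v` in `O_v` lies in `𝔪_v`** (`v(a) < 1`). [cite: Serre1979, II §1] -/
theorem valued_algebraMap_lt_one_of_mem {a : A} (ha : a ∈ v.asIdeal) :
    Valued.v ((algebraMap A (v.adicCompletionIntegers K) a : v.adicCompletionIntegers K) : v.adicCompletion K) < 1 := by
  rw [HeightOneSpectrum.algebraMap_adicCompletionIntegers_apply]
  change Valued.v (algebraMap K (v.adicCompletion K) (algebraMap A K a)) < 1
  have hval : Valued.v (algebraMap K (v.adicCompletion K) (algebraMap A K a)) = v.valuation K (algebraMap A K a) :=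
    HeightOneSpectrum.valuedAdicCompletion_eq_valuation' v _
  rw [hval, HeightOneSpectrum.valuation_lt_one_iff_mem]
  exact ha

/-- The coercion square: `((A → O_v) a : K_v) = (K → K_v)((A → K) a)`. [folklore] -/
private theorem coe_algebraMap_adicCompletionIntegers (a : A) :
    ((algebraMap A (v.adicCompletionIntegers K) a : v.adicCompletionIntegers K) : v.adicCompletion K) =
      algebraMap K (v.adicCompletion K) (algebraMap A K a) := by
  rw [HeightOneSpectrum.algebraMap_adicCompletionIntegers_apply]; rfl

/-- **`((A → O_v) a : K_v) = (K → K_v)(a)`**: the two ways of sending `a ∈ A` into `K_v` agree.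
[cite: Serre1979, II §1] -/
theorem coe_algebraMap_adicCompletionIntegers_eq (a : A) :
    ((algebraMap A (v.adicCompletionIntegers K) a : v.adicCompletionIntegers K) : v.adicCompletion K) =
      algebraMap K (v.adicCompletion K) (algebraMap A K a) :=
  coe_algebraMap_adicCompletionIntegers K v a

end Literature.NumberTheory.NumberFields

end
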